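import Summits.AtomisticToContinuum.FouriersLaw.Theses.BondHeatUncertainty

/-!
# `ExtensiveSnapshotIrreversibility` — degenerate instances hold (boundary lemmas, cdisprove)

Support file for crux item `stmt-AtomisticToContinuum-9121` (route `BondHeatUncertainty`, decl
`ExtensiveSnapshotIrreversibility`: `KL(μ_{N,T+δ/2,T-δ/2} ‖ Θ_*μ) ≤ C·N·δ²` eventually in `δ`).
The small-`N` instances of the conclusion are TRUE for every constant `C`, so a counterexample
(or the content of a proof) lives at `N ≥ 2`:

* `klDiv_flip_zero_sites`: for `N = 0` phase space is a point, the momentum flip is the identity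
  and `KL(μ ‖ Θ_*μ) = 0`;
* `gibbsMeasure_map_flip`: the Gibbs measure `Z⁻¹e^{-H/T} dq dp` of ANY oscillator chain is
  invariant under the momentum flip (`H` is even in `p`, Lebesgue measure is flip-invariant), hence
  `klDiv_flip_gibbsMeasure`: its snapshot divergence vanishes;
* `extensiveSnapshotIrreversibility_bound_at_one`: for `N = 1`, under the uniqueness guard of the
  crux, the steady state at bath temperatures `T ± δ/2` is the Gibbs measure at the mean
  temperature `T` (`pinnedChain_isSteadyState_gibbsMeasure_one`), so the bound holds with any `C`.
-/

namespace Summit.AtomisticToContinuum.FouriersLaw.Theorems.ExtensiveSnapshotIrreversibility.Negative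

open MeasureTheory Filter Topology InformationTheory
open scoped ENNReal
open Literature.MathematicalPhysics.KineticTheory.HeatConduction

/-- A flip-invariant σ-finite state has zero snapshot divergence. [folklore] -/
theorem klDiv_flip_of_map_eq {N : ℕ} {μ : Measure (PhaseSpace N)} [SigmaFinite μ]
    (h : Measure.map (fun x : PhaseSpace N => (x.1, -x.2)) μ = μ) :
    klDiv μ (Measure.map (fun x : PhaseSpace N => (x.1, -x.2)) μ) = 0 := by
  rw [h]
  exact klDiv_self μ

/-- `N = 0`: the flip is the identity of the one-point phase space, `KL(μ ‖ Θ_*μ) = 0`.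
[folklore] -/
theorem klDiv_flip_zero_sites (μ : Measure (PhaseSpace 0)) [SigmaFinite μ] :
    klDiv μ (Measure.map (fun x : PhaseSpace 0 => (x.1, -x.2)) μ) = 0 := by
  apply klDiv_flip_of_map_eq
  have : (fun x : PhaseSpace 0 => (x.1, -x.2)) = id := funext fun x => Subsingleton.elim _ _
  rw [this, Measure.map_id]

/-- **The Gibbs measure of any oscillator chain is invariant under the momentum flip**
`(q,p) ↦ (q,-p)`: `H(q,-p) = H(q,p)` and Lebesgue measure is flip-invariant
(`measurePreserving_momentumReversal`). [folklore] -/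
theorem gibbsMeasure_map_flip (P : OscillatorChain) (N : ℕ) (T : ℝ) :
    Measure.map (fun x : PhaseSpace N => (x.1, -x.2)) (P.gibbsMeasure N T) = P.gibbsMeasure N T := by
  have hf : ∀ x : PhaseSpace N, -P.hamiltonian N ((momentumReversal N) x) / T =
      -P.hamiltonian N x / T := fun x => by
    rw [momentumReversal_apply, P.hamiltonian_neg_momentum]
  show Measure.map (momentumReversal N) (P.gibbsMeasure N T) = P.gibbsMeasure N T
  rw [P.gibbsMeasure_eq]
  conv_rhs => rw [← (measurePreserving_momentumReversal N).map_eq]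
  ext s hs
  rw [Measure.map_apply (momentumReversal N).measurable hs,
    tilted_apply' _ _ ((momentumReversal N).measurable hs), tilted_apply' _ _ hs,
    integral_map_equiv, Measure.restrict_map (momentumReversal N).measurable hs,
    lintegral_map_equiv]
  simp only [hf]

/-- The equilibrium (Gibbs) state of the pinned chain has zero snapshot divergence
(`ω₂ > 0`, `lam, β ≥ 0`, `T > 0`, any `γ`). [folklore] -/
theorem klDiv_flip_gibbsMeasure {ω₂ lam β : ℝ} (hω : 0 < ω₂) (hl : 0 ≤ lam) (hβ : 0 ≤ β)
    (γ : ℝ) (N : ℕ) {T : ℝ} (hT : 0 < T) :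
    klDiv ((pinnedChain ω₂ lam β γ).gibbsMeasure N T)
      (Measure.map (fun x : PhaseSpace N => (x.1, -x.2)) ((pinnedChain ω₂ lam β γ).gibbsMeasure N T))
        = 0 := by
  haveI := pinnedChain_isProbabilityMeasure_gibbsMeasure hω hl hβ γ N hT
  exact klDiv_flip_of_map_eq (gibbsMeasure_map_flip _ N T)

/-- Both bath temperatures `T ± δ/2` are positive for `δ` near `0` when `T > 0`. [folklore] -/
theorem eventually_bath_temps_pos {T : ℝ} (hT : 0 < T) :
    ∀ᶠ δ in 𝓝[≠] (0 : ℝ), 0 < T + δ / 2 ∧ 0 < T - δ / 2 := by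
  have h2 : ∀ᶠ δ in 𝓝 (0 : ℝ), δ < 2 * T := eventually_lt_nhds (by linarith)
  have h2' : ∀ᶠ δ in 𝓝 (0 : ℝ), -(2 * T) < δ := eventually_gt_nhds (by linarith)
  filter_upwards [mem_nhdsWithin_of_mem_nhds h2, mem_nhdsWithin_of_mem_nhds h2'] with δ hlt hgt
  constructor <;> linarith

/-- **`N = 0` instance of the conclusion of `ExtensiveSnapshotIrreversibility`**: along any
steady-state family both sides vanish, for every constant `C`. [folklore] -/
theorem extensiveSnapshotIrreversibility_bound_at_zero {ω₂ lam β γ : ℝ}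
    {μ : (N : ℕ) → ℝ → ℝ → Measure (PhaseSpace N)}
    (hμ : ∀ (N : ℕ) (T_L T_R : ℝ), 0 < T_L → 0 < T_R →
      (pinnedChain ω₂ lam β γ).IsSteadyState N T_L T_R (μ N T_L T_R))
    {T : ℝ} (hT : 0 < T) (C : ℝ) :
    ∀ᶠ δ in 𝓝[≠] (0 : ℝ),
      klDiv (μ 0 (T + δ / 2) (T - δ / 2))
        (Measure.map (fun x : PhaseSpace 0 => (x.1, -x.2)) (μ 0 (T + δ / 2) (T - δ / 2)))
          ≤ ENNReal.ofReal (C * ((0 : ℕ) : ℝ) * δ ^ 2) := by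
  filter_upwards [eventually_bath_temps_pos hT] with δ hδ
  haveI := (hμ 0 _ _ hδ.1 hδ.2).1
  rw [klDiv_flip_zero_sites]
  exact bot_le

/-- **`N = 1` instance of the conclusion of `ExtensiveSnapshotIrreversibility`**: under the
uniqueness guard of the crux the steady state with baths at `T ± δ/2` on the single site is the
Gibbs measure at the mean temperature `T`, which is flip-invariant; the bound holds for every
`C`.  Hence any counterexample to the crux needs `N ≥ 2`. [folklore] -/
theorem extensiveSnapshotIrreversibility_bound_at_one {ω₂ lam β γ : ℝ} (hω : 0 < ω₂)
    (hl : 0 < lam) (hβ : 0 < β)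
    (hU : ∀ (N : ℕ) (T_L T_R : ℝ), 0 < T_L → 0 < T_R →
      ∀ μ ν : Measure (PhaseSpace N),
        (pinnedChain ω₂ lam β γ).IsSteadyState N T_L T_R μ →
        (pinnedChain ω₂ lam β γ).IsSteadyState N T_L T_R ν → μ = ν)
    {μ : (N : ℕ) → ℝ → ℝ → Measure (PhaseSpace N)}
    (hμ : ∀ (N : ℕ) (T_L T_R : ℝ), 0 < T_L → 0 < T_R →
      (pinnedChain ω₂ lam β γ).IsSteadyState N T_L T_R (μ N T_L T_R))
    {T : ℝ} (hT : 0 < T) (C : ℝ) :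
    ∀ᶠ δ in 𝓝[≠] (0 : ℝ),
      klDiv (μ 1 (T + δ / 2) (T - δ / 2))
        (Measure.map (fun x : PhaseSpace 1 => (x.1, -x.2)) (μ 1 (T + δ / 2) (T - δ / 2)))
          ≤ ENNReal.ofReal (C * ((1 : ℕ) : ℝ) * δ ^ 2) := by
  filter_upwards [eventually_bath_temps_pos hT] with δ hδ
  have heq : μ 1 (T + δ / 2) (T - δ / 2) =
      (pinnedChain ω₂ lam β γ).gibbsMeasure 1 ((T + δ / 2 + (T - δ / 2)) / 2) :=
    hU 1 _ _ hδ.1 hδ.2 _ _ (hμ 1 _ _ hδ.1 hδ.2)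
      (pinnedChain_isSteadyState_gibbsMeasure_one hω hl.le hβ.le γ hδ.1 hδ.2)
  have hT' : 0 < (T + δ / 2 + (T - δ / 2)) / 2 := by linarith
  rw [heq, klDiv_flip_gibbsMeasure hω hl.le hβ.le γ 1 hT']
  exact bot_le

end Summit.AtomisticToContinuum.FouriersLaw.Theorems.ExtensiveSnapshotIrreversibility.Negative
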